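import Literature.NumberTheory.GaloisRepresentations.CoinducedDiscreteGaloisModule
import Literature.NumberTheory.GaloisRepresentations.ContinuousShapiroLiftPullback
import Literature.NumberTheory.GaloisRepresentations.ContinuousShapiroLiftCores
import Literature.NumberTheory.GaloisRepresentations.ContinuousShapiroLiftFunctor
import Literature.NumberTheory.GaloisRepresentations.ContinuousShapiroLiftMackeyCup
import Literature.NumberTheory.GaloisRepresentations.LocalGlobalCohomology
import Literature.NumberTheory.GaloisRepresentations.TateDualityCounting
import HarnessLib

/-!
# The coinduced discrete Galois module `Maps(Γ_K ⧸ U, M)`: cup products, Shapiro, and the LOCAL Tate pairing through the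
# summed-pairing duality `Ψ : Maps(Γ_K ⧸ U, M') → Maps(Γ_K ⧸ U, M)^D` — `Proofs` companion of `CoinducedDiscreteGaloisModule.lean`

Topic `NumberTheory/GaloisRepresentations` (namespace = path). THEOREMS ONLY (no definition, no named fact, no instance, no
notation, no `sorry`).  Notation of the companion file: `ρ, ρ'` discrete `Γ_K`-modules on `M, M'`, `U ≤ Γ_K` open of finite index,
`B : M × M' → μₙ` equivariant, `P = pairing ρ ρ' μₙ B`, `Ψ = coindTateDualMor ρ ρ' U B … : Maps(Γ_K ⧸ U, M') ⟶ Maps(Γ_K ⧸ U, M)^D`.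

* §1 (global) **`a ∪_{ev} H¹(Ψ) b = a ∪_{ΣB} b`** in `H²(Γ_K, μₙ)` (`cupProduct_coindTateDualMor`; adjoint naturality of the cup
  product, the tree's `ContPairing.cupProduct_adjoint`); `H¹(Ψ)` is bijective when `m' ↦ B(·, m')` is
  (`bijective_cohomologyMap_coindTateDualMor`, via `topRepIsoOfEquiv` / `continuousCohomologyEquivOfIso`); with Shapiro
  (`shapiroLift_surjective/injective`) every class of `H¹(K, Maps(Γ_K ⧸ U, M)^D)` is `H¹(Ψ)(Sh b)` for a unique `b ∈ H¹(U, M')`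
  (`exists_unique_shapiroLift_coindTateDualMor_eq`).
* §2 (local, `K` a number field, `v` a place, `θ = Γ_{K_v} → Γ_K`, `U' ≤ Γ_{K_v}` with `θ(U') ⊆ U` and `θ̄ : Γ_{K_v} ⧸ U' → Γ_K ⧸ U`
  BIJECTIVE — one double coset, e.g. `K = ℚ`, `v = p`, `U = Γ_{ℚ_n}` a layer of the cyclotomic `ℤ_p`-tower):
  **the local Tate pairing of `Maps(Γ_K ⧸ U, M)` at `v` against a class coming from `Maps(Γ_K ⧸ U, M')|_{Γ_{K_v}}` through `Ψ` IS the
  cup product for the summed LOCAL pairing `Σ_{Γ_{K_v} ⧸ U'} B` of the pulled-back classes**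
  (`localTatePairing_coind_cohomologyMap_eq_cupProduct_pull`: the value `⟨a', Ψ_v t⟩_v` equals
  `(P_v.coindFin U')(θ̄^* a', θ̄^* t)`, `θ̄^* = H¹(coindFinPull)`), and localisation intertwines `H¹(Ψ)` with `H¹(Ψ_v)`
  (`localization_cohomologyMap_coindTateDualMor`).  With the tree's `map_coindFinPull_shapiroLift` this reads the LOCAL TERM at
  `v` of Poitou–Tate for `Maps(Γ_K ⧸ U, M)` on the cohomology `H¹(U', M)` of the completed layer field (Kobayashi's `( , )_n`).

References: [NeukirchSchmidtWingberg2008] I §4 (1.4.2), I §5 Prop. (1.5.3)(iv), I §6 Prop. (1.6.4)–(1.6.5); [MilneADT2006] I §0,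
Cor. 2.3, I §6 (proof of Prop. 6.9); [SerreLocalFields1979] VII §5–§6.
-/

noncomputable section

open CategoryTheory Function Field NumberField
open scoped Topology

universe u

namespace Literature.NumberTheory.GaloisRepresentations

namespace DiscreteGaloisModule

-- Cup products need `LocallyCompactSpace Γ`; as in `LocalTatePairing.lean` the compactness of absolute Galois groups is a
-- local instance only (a Prop-valued Mathlib class, no data).
attribute [local instance] absoluteGaloisGroup_compactSpace

variable {K : Type u} [Field K] {M M' : Type u} [AddCommGroup M] [TopologicalSpace M] [DiscreteTopology M]
  [AddCommGroup M'] [TopologicalSpace M'] [DiscreteTopology M'] [Finite M]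
  (ρ : DiscreteGaloisModule K M) (ρ' : DiscreteGaloisModule K M')
  (U : Subgroup (absoluteGaloisGroup K)) [Fintype (absoluteGaloisGroup K ⧸ U)]
  {n : ℕ} (B : M →+ M' →+ MuCarrier K n)
  (hU : IsOpen (U : Set (absoluteGaloisGroup K)))
  (hB : ∀ (σ : absoluteGaloisGroup K) (m : M) (m' : M'), B (ρ σ m) (ρ' σ m') = mu K n σ (B m m'))

/-! ## §1 Global: the cup product and the bijectivity of `H¹(Ψ)` -/

/-- **`a ∪_{ev} H¹(Ψ) b = a ∪_{ΣB} b` in `H²(Γ_K, μₙ)`**: the cup product of `a ∈ H¹(Γ_K, Maps(Γ_K ⧸ U, M))` with the image of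
`b ∈ H¹(Γ_K, Maps(Γ_K ⧸ U, M'))` under `Ψ`, for the EVALUATION pairing of the Tate dual (the pairing of the tree's local Tate pairing
/ Poitou–Tate files), is the cup product of `a` and `b` for the SUMMED pairing `Σ_y B` (the pairing of the Shapiro files) —
adjoint naturality of the cup product. [cite: NeukirchSchmidtWingberg2008, I §4 (1.4.2), I §5 Prop. (1.5.3)(iv)] -/
theorem cupProduct_coindTateDualMor (a : galoisCohomology (ρ.coind U hU) 1)
    (b : continuousCohomology.{0, u, u} 1 (coindFin.{0, u} ρ'.toTopRep U)) :
    (tateDualPairing (ρ.coind U hU) n).cupProduct a (cohomologyMap (coindTateDualMor ρ ρ' U B hU hB) 1 b) =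
      ((pairing ρ ρ' (mu K n) B hB).coindFin U).cupProduct a b := by
  have h := ContPairing.cupProduct_adjoint (tateDualPairing (ρ.coind U hU) n) ((pairing ρ ρ' (mu K n) B hB).coindFin U)
    (𝟙 (coindFin.{0, u} ρ.toTopRep U)) (coindTateDualMor ρ ρ' U B hU hB)
    (fun φ ψ => (tateDualPairing_toLin_coindTateDualMor ρ ρ' U B hU hB φ ψ).symm) a b
  have hid : (cohomologyMap (𝟙 (coindFin.{0, u} ρ.toTopRep U)) 1) a = a := by
    rw [show cohomologyMap (𝟙 (coindFin.{0, u} ρ.toTopRep U)) 1 = 𝟙 _ from map_id_eq_id _ (fun _ => rfl) 1]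
    rfl
  exact h.symm.trans (congrArg (fun a' => ((pairing ρ ρ' (mu K n) B hB).coindFin U).cupProduct a' b) hid)

/-- **`H¹(Ψ) : H¹(Γ_K, Maps(Γ_K ⧸ U, M')) → H¹(K, Maps(Γ_K ⧸ U, M)^D)` is bijective when `m' ↦ B(·, m')` is** (then `Ψ` is an
isomorphism of discrete `Γ_K`-modules, `coindTateDualHom_bijective`; `continuousCohomologyEquivOfIso`).
[cite: MilneADT2006, Ch. I §0, Cor. 2.3] [cite: NeukirchSchmidtWingberg2008, I §6] -/
theorem bijective_cohomologyMap_coindTateDualMor (hbij : Bijective fun m' : M' => B.flip m') (q : ℕ) :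
    Bijective (cohomologyMap (coindTateDualMor ρ ρ' U B hU hB) q) := by
  haveI : DiscreteTopology (coindFin.{0, u} ρ'.toTopRep U) :=
    inferInstanceAs (DiscreteTopology (absoluteGaloisGroup K ⧸ U → M'))
  haveI : DiscreteTopology (((ρ.coind U hU).tateDual n).toTopRep) :=
    inferInstanceAs (DiscreteTopology (TateDual K (absoluteGaloisGroup K ⧸ U → M) n))
  let e : (coindFin.{0, u} ρ'.toTopRep U) ≃L[ℤ] ((ρ.coind U hU).tateDual n).toTopRep :=
    { (LinearEquiv.ofBijective (coindTateDualHom U B).toIntLinearMap (coindTateDualHom_bijective U B hbij)) with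
      continuous_toFun := continuous_of_discreteTopology
      continuous_invFun := continuous_of_discreteTopology }
  have he : ∀ (g : absoluteGaloisGroup K) (x : coindFin.{0, u} ρ'.toTopRep U),
      e ((coindFin.{0, u} ρ'.toTopRep U).ρ g x) = (((ρ.coind U hU).tateDual n).toTopRep).ρ g (e x) :=
    fun g x => coindTateDualHom_smul ρ ρ' U B hU hB g x
  have hhom : (topRepIsoOfEquiv e he).hom = coindTateDualMor ρ ρ' U B hU hB := rfl
  rw [← hhom]
  exact (continuousCohomologyEquivOfIso (topRepIsoOfEquiv e he) q).bijective

/-- **Every class of `H¹(K, Maps(Γ_K ⧸ U, M)^D)` is `H¹(Ψ)(Sh b)` for a unique `b ∈ H¹(U, M')`** (Shapiro's lemma in degree one,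
`shapiroLift_injective/surjective`, composed with the bijection `H¹(Ψ)`), for `B` perfect.
[cite: NeukirchSchmidtWingberg2008, I §6 Prop. (1.6.4)] [cite: MilneADT2006, Ch. I Cor. 2.3] -/
theorem exists_unique_shapiroLift_coindTateDualMor_eq (hbij : Bijective fun m' : M' => B.flip m')
    {s : absoluteGaloisGroup K ⧸ U → absoluteGaloisGroup K} (hs : ∀ y, (s y : absoluteGaloisGroup K ⧸ U) = y)
    (hs1 : s ((1 : absoluteGaloisGroup K) : absoluteGaloisGroup K ⧸ U) = 1)
    (y : galoisCohomology ((ρ.coind U hU).tateDual n) 1) :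
    ∃! b : continuousCohomology.{0, u, u} 1 (subgroupRep ρ'.toTopRep U),
      cohomologyMap (coindTateDualMor ρ ρ' U B hU hB) 1 (shapiroLift ρ'.toTopRep U hU hs hs1 b) = y := by
  have h1 := bijective_cohomologyMap_coindTateDualMor ρ ρ' U B hU hB hbij 1
  have h2 : Bijective (shapiroLift ρ'.toTopRep U hU hs hs1) :=
    ⟨shapiroLift_injective ρ'.toTopRep U hU hs hs1, shapiroLift_surjective ρ'.toTopRep U hU hs hs1⟩
  exact (h1.comp h2).existsUnique y

/-! ## §2 Local: localisation of `H¹(Ψ)` and the local Tate pairing through the summed pairing of the pulled-back classes -/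

section Local

variable [NumberField K] (v : Place K) (U' : Subgroup (absoluteGaloisGroup (Place.Completion v)))
  (hU' : ∀ d : absoluteGaloisGroup (Place.Completion v), d ∈ U' → absGaloisRestrict K (Place.Completion v) d ∈ U)

/-- **Localisation intertwines `H¹(Ψ)` with `H¹(Ψ|_{Γ_{K_v}})`**: for `b ∈ H¹(Γ_K, Maps(Γ_K ⧸ U, M'))`,
`loc_v (H¹(Ψ) b) = H¹(Γ_{K_v}, Ψ) (θ^* b)`, where `θ^* : H¹(Γ_K, Maps) → H¹(Γ_{K_v}, Maps|_θ)` is restriction along `θ = Γ_{K_v} → Γ_K`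
with the identity on coefficients and `Ψ` is read as a morphism `Maps(Γ_K ⧸ U, M')|_θ ⟶ (Maps(Γ_K ⧸ U, M)^D)|_{Γ_{K_v}}` (on cocycles both
sides are `d ↦ Ψ(b(θ d))`). [cite: NeukirchSchmidtWingberg2008, I §5 (1.5.2)] -/
theorem localization_cohomologyMap_coindTateDualMor (b : continuousCohomology.{0, u, u} 1 (coindFin.{0, u} ρ'.toTopRep U)) :
    galoisCohomology.localization ((ρ.coind U hU).tateDual n) v 1 (cohomologyMap (coindTateDualMor ρ ρ' U B hU hB) 1 b) =
      cohomologyMap (TopRep.ofHom ⟨(coindTateDualMor ρ ρ' U B hU hB).hom.toContinuousLinearMap, fun d =>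
          (coindTateDualMor ρ ρ' U B hU hB).hom.isIntertwining' (absGaloisRestrict K (Place.Completion v) d)⟩ :
        TopRep.res (absGaloisRestrict K (Place.Completion v) : absoluteGaloisGroup (Place.Completion v) →* absoluteGaloisGroup K) (coindFin.{0, u} ρ'.toTopRep U) ⟶
          (((ρ.coind U hU).tateDual n).toLocal v).toTopRep) 1
        (ContinuousCohomology.map (absGaloisRestrict K (Place.Completion v))
          (𝟙 (TopRep.res (absGaloisRestrict K (Place.Completion v) : absoluteGaloisGroup (Place.Completion v) →* absoluteGaloisGroup K) (coindFin.{0, u} ρ'.toTopRep U))) 1 b) := by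
  obtain ⟨g, rfl⟩ := oneCocycleClass_surjective _ b
  rw [cohomologyMap_oneCocycleClass, map_oneCocycleClass, cohomologyMap_oneCocycleClass]
  change ContinuousCohomology.map (absGaloisRestrict K (Place.Completion v)) _ 1 _ = _
  rw [map_oneCocycleClass]
  rfl

/-- **The local Tate pairing of `Maps(Γ_K ⧸ U, M)` at `v` through `Ψ`, as the cup product of the pulled-back classes for the LOCAL summed
pairing.**  Let `θ = Γ_{K_v} → Γ_K`, `U' ≤ Γ_{K_v}` with `θ(U') ⊆ U` and `θ̄ : Γ_{K_v} ⧸ U' → Γ_K ⧸ U` bijective (one double coset), and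
`θ̄^* = H¹(coindFinPull) : H¹(Γ_{K_v}, Maps(Γ_K ⧸ U, ·)|_θ) → H¹(Γ_{K_v}, Maps(Γ_{K_v} ⧸ U', ·|_θ))`.  For `a' ∈ H¹(K_v, Maps(Γ_K ⧸ U, M))` and
`t ∈ H¹(Γ_{K_v}, Maps(Γ_K ⧸ U, M')|_θ)`:

  `⟨a', H¹(Γ_{K_v}, Ψ) t⟩_v = θ̄^* a' ∪_{Σ_{Γ_{K_v}⧸U'} B} θ̄^* t`  in `H²(K_v, μₙ)`

(local Tate pairing `localTatePairing` = cup product for the evaluation pairing of `Maps(Γ_K ⧸ U, M)^D`; on cocycles the identity is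
`Σ_{y ∈ Γ_K⧸U} B(φ y, ψ y) = Σ_{z ∈ Γ_{K_v}⧸U'} B(φ(θ̄ z), ψ(θ̄ z))`).  This is the local term at `v` of Poitou–Tate for the induced module, read on the
layer `U'` (Kobayashi's `( , )_n`; Milne I §6, proof of Prop. 6.9). [cite: NeukirchSchmidtWingberg2008, I §5 Prop. (1.5.3)(iv), I §6 (1.6.5)]
[cite: MilneADT2006, Ch. I Cor. 2.3] -/
theorem localTatePairing_coind_cohomologyMap_eq_cupProduct_pull [Fintype (absoluteGaloisGroup (Place.Completion v) ⧸ U')]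
    (hbij : Bijective (quotientPull U (absGaloisRestrict K (Place.Completion v)) U' hU'))
    (a' : continuousCohomology.{0, u, u} 1
      (TopRep.res (absGaloisRestrict K (Place.Completion v) : absoluteGaloisGroup (Place.Completion v) →* absoluteGaloisGroup K) (coindFin.{0, u} ρ.toTopRep U)))
    (t : continuousCohomology.{0, u, u} 1
      (TopRep.res (absGaloisRestrict K (Place.Completion v) : absoluteGaloisGroup (Place.Completion v) →* absoluteGaloisGroup K) (coindFin.{0, u} ρ'.toTopRep U))) :
    localTatePairing (ρ.coind U hU) n v a'
        (cohomologyMap (TopRep.ofHom ⟨(coindTateDualMor ρ ρ' U B hU hB).hom.toContinuousLinearMap, fun d =>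
            (coindTateDualMor ρ ρ' U B hU hB).hom.isIntertwining' (absGaloisRestrict K (Place.Completion v) d)⟩ :
          TopRep.res (absGaloisRestrict K (Place.Completion v) : absoluteGaloisGroup (Place.Completion v) →* absoluteGaloisGroup K) (coindFin.{0, u} ρ'.toTopRep U) ⟶
            (((ρ.coind U hU).tateDual n).toLocal v).toTopRep) 1 t) =
      ((pairing (ρ.toLocal v) (ρ'.toLocal v) ((mu K n).toLocal v) B fun σ m m' =>
            hB (absGaloisRestrict K (Place.Completion v) σ) m m').coindFin U').cupProduct
        (cohomologyMap (coindFinPull ρ.toTopRep U (absGaloisRestrict K (Place.Completion v))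
          (TopRep.ofHom ⟨ContinuousLinearMap.id ℤ M, fun _ => rfl⟩ :
            TopRep.res (absGaloisRestrict K (Place.Completion v) : absoluteGaloisGroup (Place.Completion v) →* absoluteGaloisGroup K) ρ.toTopRep ⟶ (ρ.toLocal v).toTopRep)
          U' hU') 1 a')
        (cohomologyMap (coindFinPull ρ'.toTopRep U (absGaloisRestrict K (Place.Completion v))
          (TopRep.ofHom ⟨ContinuousLinearMap.id ℤ M', fun _ => rfl⟩ :
            TopRep.res (absGaloisRestrict K (Place.Completion v) : absoluteGaloisGroup (Place.Completion v) →* absoluteGaloisGroup K) ρ'.toTopRep ⟶ (ρ'.toLocal v).toTopRep)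
          U' hU') 1 t) := by
  obtain ⟨f, rfl⟩ := oneCocycleClass_surjective _ a'
  obtain ⟨g, rfl⟩ := oneCocycleClass_surjective _ t
  rw [cohomologyMap_oneCocycleClass, cohomologyMap_oneCocycleClass, cohomologyMap_oneCocycleClass,
    ContPairing.cupProduct_oneCocycleClass_eq_twoCocycleClass]
  erw [localTatePairing_oneCocycleClass, ContPairing.cupClass_eq_twoCocycleClass]
  congr 1
  apply Subtype.ext
  ext ⟨σ, τ⟩
  rw [ContPairing.cupCocycle_apply, ContPairing.cupCocycle_apply]
  repeat rw [pullback_id_resIdHom_apply]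
  rw [map_sub, map_sub]
  refine congrArg₂ (· - ·) ?_ ?_ <;>
  · change tateDualEval K (absoluteGaloisGroup K ⧸ U → M) n (f.1 σ) (coindTateDualHom U B (g.1 _)) = _
    rw [tateDualEval_coindTateDualHom, ContPairing.coindFin_toLin_apply, ← (Equiv.ofBijective _ hbij).sum_comp]
    rfl

end Local

/-! ## §3 Local, MANY orbits: the local Tate pairing of `Maps(Γ_K ⧸ U, M)` at `v` through `Ψ` as the ORBIT SUM of the layer-`θ⁻¹U`
summed-pairing cup products of the Mackey coordinates `H¹(Φ_{c_i})` (`Φ_c = resCoindFinHomR`, `ContinuousShapiroLiftMackeyCup.lean`) — the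
many-double-coset twin of §2 (there: one orbit, `θ̄^* = H¹(coindFinPull)`); `(Equiv.ofBijective _ hbij).sum_comp` is replaced by the orbit
splitting `ContPairing.coindFin_toLin_sum_resCoindFinHomR`. (Typed and kernel-checked first in the crux sketch
`Summits/…/Cruxes/ResidualThetaCountLowerPureAtTwo/Sketch_sidea_k2_g12.lean` §E, stub-ideation k2 g12; landed verbatim.) -/

section LocalManyOrbits

variable [U.Normal] [NumberField K] (v : Place K)


/-- **The local Tate pairing of `Maps(Γ_K ⧸ U, M)` at `v`, MANY ORBITS.**  Let `θ = Γ_{K_v} → Γ_K`, `U' = θ⁻¹U`, `ē : Γ_{K_v} ⧸ U' → Γ_K ⧸ U`,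
and `c : ι → Γ_K ⧸ U` with `(i, z) ↦ ē(z)·c_i` BIJECTIVE (`{c_i}` = representatives of the `Γ_{K_v}`-orbits on `Γ_K ⧸ U` = the places of the
fixed field of `U` above `v`).  For a local class `a' ∈ H¹(K_v, Maps(Γ_K ⧸ U, M))` and `t ∈ H¹(Γ_{K_v}, Maps(Γ_K ⧸ U, M')|_θ)`:

  `⟨a', H¹(Ψ_v) t⟩_v = Σ_i  H¹(Φ_{c_i}) a' ∪_{Σ_{U'} B_v} H¹(Φ_{c_i}) t`   in `H²(K_v, μₙ)`,

i.e. the local term of Poitou–Tate for the induced module is the SUM over the places `w_i ∣ v` of the layer-`U'` summed-pairing cup products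
of the Mackey coordinates (on cocycles: `Σ_{y ∈ Γ_K⧸U} B(φ y, ψ y) = Σ_i Σ_{z ∈ Γ_{K_v}⧸U'} B(φ(ē z·c_i), ψ(ē z·c_i))`).  With (M) §3
`map_resCoindFinHomR_shapiroLift` each coordinate of a restricted GLOBAL Shapiro lift `θ^*(Sh_U b)` is the local Shapiro lift of the conjugated
layer localisation `θ_U^*(g_i·b)`, so each summand is the tree's LAYER pairing in the Shapiro model (`…LayerPairingModDefs`:
`⟨x, y⟩_{n} = inv_v(Sh(x) ∪_{Σ} Sh(y))`) at the place `w_i`.  Literature: the semi-local decomposition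
`H¹(K_v, Ind M) = ⊕_{w∣v} H¹(L_w, M)` compatible with the local pairings (Milne ADT I, proof of Prop. 6.9 / Cor. 2.3; NSW (7.1.?) via (1.5.3)(iv),
(1.6.4)–(1.6.5); Greenberg LNM 1716 §4 `𝒫^{(v)}(F_n) = ∏_{v_n∣v} ℋ((F_n)_{v_n})`). [cite: NeukirchSchmidtWingberg2008, I §5 Prop. (1.5.3)(iv), I §6 (1.6.5)]
[cite: MilneADT2006, Ch. I Cor. 2.3] [cite: Brown1982, III §5 (5.6)(b)] -/
theorem localTatePairing_coind_eq_sum_cupProduct_resCoindFinHomR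
    [Fintype (absoluteGaloisGroup (Place.Completion v) ⧸
      U.comap (absGaloisRestrict K (Place.Completion v) : absoluteGaloisGroup (Place.Completion v) →* absoluteGaloisGroup K))]
    {ι : Type*} [Fintype ι] (c : ι → absoluteGaloisGroup K ⧸ U)
    (hbij : Bijective fun q : ι × (absoluteGaloisGroup (Place.Completion v) ⧸
        U.comap (absGaloisRestrict K (Place.Completion v) : absoluteGaloisGroup (Place.Completion v) →* absoluteGaloisGroup K)) =>
        quotientMapOfHom U (absGaloisRestrict K (Place.Completion v)) q.2 * c q.1)
    (a' : continuousCohomology.{0, u, u} 1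
      (TopRep.res (absGaloisRestrict K (Place.Completion v) : absoluteGaloisGroup (Place.Completion v) →* absoluteGaloisGroup K)
        (coindFin.{0, u} ρ.toTopRep U)))
    (t : continuousCohomology.{0, u, u} 1
      (TopRep.res (absGaloisRestrict K (Place.Completion v) : absoluteGaloisGroup (Place.Completion v) →* absoluteGaloisGroup K)
        (coindFin.{0, u} ρ'.toTopRep U))) :
    localTatePairing (ρ.coind U hU) n v a'
        (cohomologyMap (TopRep.ofHom ⟨(coindTateDualMor ρ ρ' U B hU hB).hom.toContinuousLinearMap, fun d =>
            (coindTateDualMor ρ ρ' U B hU hB).hom.isIntertwining' (absGaloisRestrict K (Place.Completion v) d)⟩ :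
          TopRep.res (absGaloisRestrict K (Place.Completion v) : absoluteGaloisGroup (Place.Completion v) →* absoluteGaloisGroup K)
              (coindFin.{0, u} ρ'.toTopRep U) ⟶
            (((ρ.coind U hU).tateDual n).toLocal v).toTopRep) 1 t) =
      ∑ i, ((pairing (ρ.toLocal v) (ρ'.toLocal v) ((mu K n).toLocal v) B fun σ m m' =>
            hB (absGaloisRestrict K (Place.Completion v) σ) m m').coindFin
            (U.comap (absGaloisRestrict K (Place.Completion v) :
              absoluteGaloisGroup (Place.Completion v) →* absoluteGaloisGroup K))).cupProduct
        (cohomologyMap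
          (resCoindFinHomR ρ.toTopRep U (absGaloisRestrict K (Place.Completion v)) (c i) ≫
            coindFinMap (TopRep.ofHom ⟨ContinuousLinearMap.id ℤ M, fun _ => rfl⟩ :
              TopRep.res (absGaloisRestrict K (Place.Completion v) : absoluteGaloisGroup (Place.Completion v) →* absoluteGaloisGroup K)
                ρ.toTopRep ⟶ (ρ.toLocal v).toTopRep)
              (U.comap (absGaloisRestrict K (Place.Completion v) :
                absoluteGaloisGroup (Place.Completion v) →* absoluteGaloisGroup K))) 1 a')
        (cohomologyMap
          (resCoindFinHomR ρ'.toTopRep U (absGaloisRestrict K (Place.Completion v)) (c i) ≫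
            coindFinMap (TopRep.ofHom ⟨ContinuousLinearMap.id ℤ M', fun _ => rfl⟩ :
              TopRep.res (absGaloisRestrict K (Place.Completion v) : absoluteGaloisGroup (Place.Completion v) →* absoluteGaloisGroup K)
                ρ'.toTopRep ⟶ (ρ'.toLocal v).toTopRep)
              (U.comap (absGaloisRestrict K (Place.Completion v) :
                absoluteGaloisGroup (Place.Completion v) →* absoluteGaloisGroup K))) 1 t) := by
  obtain ⟨f, rfl⟩ := oneCocycleClass_surjective _ a'
  obtain ⟨g, rfl⟩ := oneCocycleClass_surjective _ t
  simp only [cohomologyMap_oneCocycleClass, ContPairing.cupProduct_oneCocycleClass_eq_twoCocycleClass]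
  erw [localTatePairing_oneCocycleClass, ContPairing.cupClass_eq_twoCocycleClass]
  simp only [← twoCocycleClassₗ_apply, ← map_sum]
  congr 1
  refine Subtype.ext (ContinuousMap.ext fun p => ?_)
  obtain ⟨σ, τ⟩ := p
  rw [Submodule.coe_sum, ContinuousMap.sum_apply, ContPairing.cupCocycle_apply]
  repeat rw [pullback_id_resIdHom_apply]
  rw [map_sub]
  trans ∑ i,
    (((pairing (ρ.toLocal v) (ρ'.toLocal v) ((mu K n).toLocal v) B fun σ m m' =>
            hB (absGaloisRestrict K (Place.Completion v) σ) m m').coindFin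
            (U.comap (absGaloisRestrict K (Place.Completion v) :
              absoluteGaloisGroup (Place.Completion v) →* absoluteGaloisGroup K))).toLin
        ((resCoindFinHomR ρ.toTopRep U (absGaloisRestrict K (Place.Completion v)) (c i) ≫
            coindFinMap (TopRep.ofHom ⟨ContinuousLinearMap.id ℤ M, fun _ => rfl⟩ :
              TopRep.res (absGaloisRestrict K (Place.Completion v) : absoluteGaloisGroup (Place.Completion v) →* absoluteGaloisGroup K)
                ρ.toTopRep ⟶ (ρ.toLocal v).toTopRep)
              (U.comap (absGaloisRestrict K (Place.Completion v) :
                absoluteGaloisGroup (Place.Completion v) →* absoluteGaloisGroup K))).hom (f.1 σ))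
        ((resCoindFinHomR ρ'.toTopRep U (absGaloisRestrict K (Place.Completion v)) (c i) ≫
            coindFinMap (TopRep.ofHom ⟨ContinuousLinearMap.id ℤ M', fun _ => rfl⟩ :
              TopRep.res (absGaloisRestrict K (Place.Completion v) : absoluteGaloisGroup (Place.Completion v) →* absoluteGaloisGroup K)
                ρ'.toTopRep ⟶ (ρ'.toLocal v).toTopRep)
              (U.comap (absGaloisRestrict K (Place.Completion v) :
                absoluteGaloisGroup (Place.Completion v) →* absoluteGaloisGroup K))).hom (g.1 (σ * τ))) -
      ((pairing (ρ.toLocal v) (ρ'.toLocal v) ((mu K n).toLocal v) B fun σ m m' =>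
            hB (absGaloisRestrict K (Place.Completion v) σ) m m').coindFin
            (U.comap (absGaloisRestrict K (Place.Completion v) :
              absoluteGaloisGroup (Place.Completion v) →* absoluteGaloisGroup K))).toLin
        ((resCoindFinHomR ρ.toTopRep U (absGaloisRestrict K (Place.Completion v)) (c i) ≫
            coindFinMap (TopRep.ofHom ⟨ContinuousLinearMap.id ℤ M, fun _ => rfl⟩ :
              TopRep.res (absGaloisRestrict K (Place.Completion v) : absoluteGaloisGroup (Place.Completion v) →* absoluteGaloisGroup K)
                ρ.toTopRep ⟶ (ρ.toLocal v).toTopRep)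
              (U.comap (absGaloisRestrict K (Place.Completion v) :
                absoluteGaloisGroup (Place.Completion v) →* absoluteGaloisGroup K))).hom (f.1 σ))
        ((resCoindFinHomR ρ'.toTopRep U (absGaloisRestrict K (Place.Completion v)) (c i) ≫
            coindFinMap (TopRep.ofHom ⟨ContinuousLinearMap.id ℤ M', fun _ => rfl⟩ :
              TopRep.res (absGaloisRestrict K (Place.Completion v) : absoluteGaloisGroup (Place.Completion v) →* absoluteGaloisGroup K)
                ρ'.toTopRep ⟶ (ρ'.toLocal v).toTopRep)
              (U.comap (absGaloisRestrict K (Place.Completion v) :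
                absoluteGaloisGroup (Place.Completion v) →* absoluteGaloisGroup K))).hom (g.1 σ)))
  · rw [Finset.sum_sub_distrib]
    refine congrArg₂ (· - ·) ?_ ?_ <;>
    · change ((pairing ρ ρ' (mu K n) B hB).coindFin U).toLin (f.1 σ) (g.1 _) = _
      rw [ContPairing.coindFin_toLin_sum_resCoindFinHomR (pairing ρ ρ' (mu K n) B hB) U
        (absGaloisRestrict K (Place.Completion v)) c hbij]
      refine Finset.sum_congr rfl fun i _ => ?_
      rfl
  · refine Finset.sum_congr rfl fun i _ => ?_
    rw [ContPairing.cupCocycle_apply]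
    repeat rw [pullback_id_resIdHom_apply]
    rw [map_sub]


end LocalManyOrbits

end DiscreteGaloisModule

end Literature.NumberTheory.GaloisRepresentations

end
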